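import Literature.Algebra.PolynomialIdentities.WeightedAverages
import Mathlib.Algebra.Order.Archimedean.Real.Basic
import Mathlib.Data.Fintype.BigOperators
import HarnessLib

/-!
# The fork at [IUTchIII] Corollary 3.12, XXII: the two readings of (Ind1) at [IUTchIV] Thm. 1.10 Step (v)

Record-only file (D-0012) of the abc-iut cell's fork skeleton (seat abc-iut-skel); TAKES NO SIDE. It types,
one level below the reals and over the tree's [IUTchIV] Prop. 1.7 (`WeightedAverages`, STEP-0 file), the
in-cell question RISK 7 (HOME/VERDICT.md; abc-iut-c312-d1's STEPV-IND1-NOTE, kernel piece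
`Literature.IUT.LogVolume.MultiradialRegionInd1Bound` p406699): how the indeterminacy (Ind1) enters the
computation of the `(j, v_ℚ)`-component of `−|log(Θ)|` in the proof of [IUTchIV] Theorem 1.10, Step (v).

THE PRINT (kurims texts; line numbers of this seat's renders). [IUTchIII] Introduction p. 12 l. 36–41:
"(Ind1): This is the indeterminacy that arises from the automorphisms of processions of `D⊢`-prime-strips
… — i.e., more concretely, from permutation automorphisms of the label sets `S^±_{j+1}` that appear in the
processions discussed above, as well as from the automorphisms of the `D⊢`-prime-strips that appear in
these processions." [IUTchIII] Cor. 3.12 p. 173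
l. 50 – p. 174 l. 3: "the holomorphic hull … of the union of the possible images of a Θ-pilot object …,
which we regard as subject to the indeterminacies (Ind1), (Ind2), (Ind3)". [IUTchIV] Thm. 1.10, Step (iv)
p. 27: the component at `v_ℚ` of the packet `I^ℚ(S^±_{j+1}; ^{n,∘}D⊢_{v_ℚ})` is "a tensor product of `j+1`
copies, indexed by the elements of `S^±_{j+1}`, of the direct sum of the `ℚ`-spans of the log-shells
associated to each of the elements of `V(F_mod)_{v_ℚ}`", so that "for each collection `{v_i}_{i∈S^±_{j+1}}` of
[not necessarily distinct!] elements of `V(F_mod)_{v_ℚ}`, we must estimate the component of the log-volume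
in question corresponding to … this collection … and then compute the weighted average [cf. … Remark
1.7.1], over possible collections". Step (v) p. 27 l. 32 – p. 28 l. 75: apply Prop. 1.4 (iii) with
"`i†` to be `j ∈ S^±_{j+1}`", "`λ` to be `0` if `v_j ∈ V^good`", "`λ` to be "`ord(−)`" of the element
`q_{v_j}^{j²}` … if `v_j ∈ V^bad`"; "the indeterminacies (Ind1) and (Ind2) are taken into account by the
arbitrary nature of the automorphism "`φ`" [cf. Proposition 1.2]"; "unlike the other terms …, "`λ`" is
asymmetric with respect to the choice of "`i† ∈ I`" in `S^±_{j+1}`. Since we would like to compute weighted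
averages …, we thus observe that, after symmetrizing with respect to the choice of "`i† ∈ I`" in
`S^±_{j+1}`, this upper bound may be written in the form "`β_e⃗`" [cf. the notation of Proposition 1.7] …
it follows immediately from the first equality of the first display of Proposition 1.7 that, after
passing to weighted averages, the operation of symmetrizing with respect to the choice of "`i† ∈ I`" in
`S^±_{j+1}` does not affect the computation of the upper bound under consideration."

THE TWO READINGS, for ONE component `(j, v_ℚ)`. Data: the finite nonempty set `E = V(F_mod)_{v_ℚ}` of
places, weights `λ_e = [(F_mod)_v : ℚ_{v_ℚ}] > 0` (Rmk. 1.7.1 p. 17), `j+1 = m+1` slots, and for each place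
`e` the "gain" `c_e ≥ 0` carried by the asymmetric term — in print `c_e = (j²/(2l))·log(q_e)` for
`e ∈ V^bad`, `c_e = 0` for `e ∈ V^good` (the term "`−λ·log(p)`" of the displayed upper bound, p. 28 l. 4–8).
* (S) SYMMETRY READING (what Step (v) computes): for the ordered collection `e⃗ ∈ E^{j+1}` the upper bound
  uses the gain of the distinguished slot only, `c(e⃗(i†))` (`gainAt`; p. 27 l. 48 "`i†` to be `j`");
  (Ind1) acts on the labels of the whole situation, the hull is formed in each labelled picture, and the
  label-dependence disappears on passing to the weighted average — PROVED here: `aggregate_gainAt` and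
  `aggregate_gainSymm` both equal `c_avg` (exactly [IUTchIV] Prop. 1.7, both clauses: "symmetrizing … does
  not affect"), i.e. the driving term `−(j²/2l)·log(q_{v_ℚ})` of the display p. 28 l. 72–75.
* (U) UNION READING (what the typed nouns deliver on the printed Θ-pilot region): the possible images
  include the translates by ALL capsule permutations `σ ∈ Perm(S^±_{j+1})` (abc-iut-c312-1
  `Thm311.LogShells.Ind1`: "ONE permutation `σ` for every `v_ℚ` (it permutes the capsule)"; abc-iut-c312-7
  `Cor312.Setting.possibleImages`; Dupuy–Hilado §4.11 `U_Θ = Ind2(Ind1((O_𝕃(−P_Θ))^{Ind3}))`), so the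
  `e⃗`-component of the UNION contains the twist at EVERY slot `k` with the gain of the place `e⃗(k)`
  (abc-iut-c312-d1, real packet: `perm_image_region_subset_UThetaUnion`), and any upper bound for the
  `e⃗`-component of the holomorphic HULL of the union can use at most the least gain `min_k c(e⃗(k))`
  (`gainMin`; real packet: `MultiradialRegionInd1Bound.le_of_logμ_hullUTheta_le`).

PROVED (bookkeeping, neutral): `aggregate_gainMin_le` — the (U)-aggregate never exceeds the (S)-aggregate
`c_avg`; `aggregate_gainMin_eq_of_const` — they coincide when the gain is constant on `E` (in particular
when `V(F_mod)_{v_ℚ}` is a singleton, `aggregate_gainMin_eq_of_subsingleton`: e.g. `F_mod = ℚ`, `d_mod = 1`);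
`aggregate_gainMin_lt` — they differ as soon as two places over `v_ℚ` carry different gains (`j ≥ 1`);
`aggregate_gainMin_le_collapse` — if the places of a subset `G ⊆ E` of weight fraction `ω` carry gain `0`
(e.g. good places) and all gains are `≤ M`, the (U)-aggregate is `≤ M·(1−ω)^{j+1}` (abc-iut-c312-d1's
quantitative appendix, kernel-checked here at the level of weighted sums); and §4, the per-collection
CONTAINMENT sentence of Step (v) ("[the box] contains the "union of possible images of a Θ-pilot object"",
p. 27 l. 62–63) in exponent bookkeeping: with all slot-twists present it holds iff
`⌊λ_{i†} − δ⌋ ≤ min_k λ_k` (`containsAllSlots_iff`), which fails whenever some slot's exponent is below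
`λ_{i†} − δ − 1` (`not_containsAllSlots`), and holds trivially for the distinguished slot alone
(`contains_distinguished`).

So the kernel displays, without adjudicating: the printed Step (v) number is the (S)-aggregate; the nouns
of Cor. 3.12 AS TYPED in the tree ((Ind1) ∋ all capsule permutations, hull of the union), on the printed
Θ-pilot region (twist `q_{v_j}^{j²}` in the slot `i† = j`), deliver only the (U)-aggregate; for `j ≥ 1`
they agree iff the gain `(j²/2l)·log(q_v)` is the same at every place of `F_mod` over `v_ℚ` — always for
`d_mod = 1`, not in general for `d_mod > 1` (the generality the compactly-bounded-subset route to `ABC`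
uses, HOME/VERDICT.md ¶7). Which reading the author intends is the question R3 of the
STEPV-IND1-NOTE; the locators above are the evidence either way ([IUTchIII] p. 12 l. 38 and Cor. 3.12's
"union … subject to (Ind1)" (p. 174 l. 2–3) for (U); [IUTchIV] p. 27 l. 63–65 "taken into account by …
"`φ`"" and p. 28 l. 67–70 "symmetrizing … does not affect" for (S); [IUTchI] Prop. 4.11 (i) p. 120 l. 47–50
"there are precisely `n` possibilities for the element ∈ `F_l^⋇` to which a given index … corresponds"
bears on both).

[claim: Mochizuki2012, status: disputed] ([IUTchIII] p. 12, Thm. 3.11 (i) p. 154, Cor. 3.12 pp. 173–174;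
[IUTchIV] Prop. 1.7 p. 16, Rmk. 1.7.1 p. 17, Thm. 1.10 Steps (iv)–(v) pp. 27–28; [IUTchI] Def. 4.10,
Prop. 4.11 (i) pp. 119–120) [cite: DupuyHilado2025, §4.7, §4.11]
Deliberately NOT here: tensor packets, `p`-adic fields, hulls (c312-d1 / c312-3 / S-seats); any judgement.
-/

noncomputable section

open Finset

namespace Summit.ABC.IUTFork.Ind1StepV

open Literature.Algebra.PolynomialIdentities.WeightedAverage

variable {E : Type} [Fintype E] {m : ℕ}

/-! ## §1. Per-collection gains under the two readings, and the weighted aggregate -/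

/-- **(S) per-collection gain**: the gain of the place in the DISTINGUISHED slot `i†` only — Step (v)
p. 27 l. 48–54: "`i†` to be `j ∈ S^±_{j+1}`", "`λ` to be "`ord(−)`" of the element `q_{v_j}^{j²}`". For an
ordered collection `e⃗ : S^±_{j+1} → V(F_mod)_{v_ℚ}` (`Fin (m+1) → E`, `m + 1 = j + 1`).
[claim: Mochizuki2012, status: disputed] -/
def gainAt (c : E → ℝ) (i : Fin (m + 1)) (e : Fin (m + 1) → E) : ℝ := c (e i)

/-- **(S), symmetrised**: the average over the choice of `i† ∈ S^±_{j+1}` of the distinguished-slot gains,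
`(1/(j+1))·Σ_k c(e⃗(k))` = `(1/(j+1))·β_e⃗` in the notation of Prop. 1.7 — "after symmetrizing with
respect to the choice of "`i† ∈ I`" … this upper bound may be written in the form "`β_e⃗`"" (p. 28
l. 41–44; the printed `β_e` carries the `q`-term as `−(j²/(2l(j+1)))·log(q_v)`, l. 53–58).
[claim: Mochizuki2012, status: disputed] -/
def gainSymm (c : E → ℝ) (e : Fin (m + 1) → E) : ℝ := (1 / (m + 1 : ℝ)) * tupleBeta c e

/-- **(U) per-collection gain**: the LEAST gain over the slots, `min_k c(e⃗(k))` — all that survives when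
the `e⃗`-component contains the twist at every slot (hull of the UNION over the capsule permutations of
(Ind1): [IUTchIII] p. 12 l. 38 "permutation automorphisms of the label sets `S^±_{j+1}`"; Cor. 3.12 p. 173
l. 50 "union of the possible images … subject to (Ind1)"; abc-iut-c312-d1 `MultiradialRegionInd1Bound`).
[claim: Mochizuki2012, status: disputed] -/
def gainMin (c : E → ℝ) (e : Fin (m + 1) → E) : ℝ :=
  Finset.univ.inf' Finset.univ_nonempty fun k => c (e k)

/-- The **weighted aggregate** of a per-collection quantity `g` over all ordered collections
`e⃗ ∈ E^{j+1}` with the weights `λ_Πe⃗ = Π_k λ_{e⃗(k)}` of Prop. 1.7 / Rmk. 1.7.1 ("the appropriate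
normalized weights are given by the expressions `λ_Πe⃗† / Σ_{e⃗} λ_Πe⃗`", p. 18 l. 3–6):
`(Σ_{e⃗} g(e⃗)·λ_Πe⃗) / (Σ_{e⃗} λ_Πe⃗)`. [claim: Mochizuki2012, status: disputed] -/
def aggregate (lam : E → ℝ) (g : (Fin (m + 1) → E) → ℝ) : ℝ :=
  (∑ e : Fin (m + 1) → E, g e * tupleLam lam e) / ∑ e : Fin (m + 1) → E, tupleLam lam e

omit [Fintype E] in
/-- Every tuple weight `λ_Πe⃗` is positive. [folklore] -/
theorem tupleLam_pos {lam : E → ℝ} (hlam : ∀ e, 0 < lam e) (e : Fin (m + 1) → E) : 0 < tupleLam lam e :=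
  Finset.prod_pos fun k _ => hlam (e k)

/-- The total weight `Σ_{e⃗} λ_Πe⃗ = λ_E^{j+1}` is positive. [folklore] -/
theorem sum_tupleLam_pos [Nonempty E] {lam : E → ℝ} (hlam : ∀ e, 0 < lam e) :
    0 < ∑ e : Fin (m + 1) → E, tupleLam lam e := by
  rw [← lamTotal_pow]
  exact pow_pos (lamTotal_pos hlam) _

/-- The aggregate is monotone in the per-collection quantity. [folklore] -/
theorem aggregate_mono [Nonempty E] {lam : E → ℝ} (hlam : ∀ e, 0 < lam e) {g g' : (Fin (m + 1) → E) → ℝ}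
    (h : ∀ e, g e ≤ g' e) : aggregate lam g ≤ aggregate lam g' := by
  unfold aggregate
  refine div_le_div_of_nonneg_right ?_ (sum_tupleLam_pos hlam).le
  exact Finset.sum_le_sum fun e _ => mul_le_mul_of_nonneg_right (h e) (tupleLam_pos hlam e).le

/-! ## §2. Reading (S): "symmetrizing … does not affect the computation" = [IUTchIV] Prop. 1.7 -/

/-- **(S), distinguished slot**: the weighted aggregate of the distinguished-slot gains is the weighted
average `c_avg = (Σ_e c_e λ_e)/(Σ_e λ_e)` over the places of `F_mod` over `v_ℚ` — for EVERY choice of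
`i†` (second clause of Prop. 1.7, divided by `n = j+1`). In print this is the term `−(j²/2l)·log(q_{v_ℚ})`
of the display p. 28 l. 72–75. [claim: Mochizuki2012, status: disputed] -/
theorem aggregate_gainAt [Nonempty E] (c : E → ℝ) {lam : E → ℝ} (hlam : ∀ e, 0 < lam e)
    (i : Fin (m + 1)) : aggregate lam (gainAt c i) = betaAvg c lam := by
  have h := (weightedAverage_eq c lam hlam m i).2
  have hn : ((m + 1 : ℕ) : ℝ) ≠ 0 := by positivity
  unfold aggregate gainAt
  have e1 : ∑ e : Fin (m + 1) → E, ((m + 1 : ℕ) : ℝ) * c (e i) * tupleLam lam e =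
      ((m + 1 : ℕ) : ℝ) * ∑ e : Fin (m + 1) → E, c (e i) * tupleLam lam e := by
    rw [Finset.mul_sum]
    exact Finset.sum_congr rfl fun e _ => by ring
  rw [e1, mul_div_assoc] at h
  exact mul_left_cancel₀ hn h

/-- **(S), symmetrised**: the weighted aggregate of the symmetrised gains is the same `c_avg` (first clause
of Prop. 1.7, divided by `n = j+1`): "after passing to weighted averages, the operation of symmetrizing
with respect to the choice of "`i† ∈ I`" in `S^±_{j+1}` does not affect the computation of the upper bound
under consideration" (p. 28 l. 66–70) — kernel-true AS AN IDENTITY OF WEIGHTED SUMS.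
[claim: Mochizuki2012, status: disputed] -/
theorem aggregate_gainSymm [Nonempty E] (c : E → ℝ) {lam : E → ℝ} (hlam : ∀ e, 0 < lam e) :
    aggregate lam (gainSymm (m := m) c) = betaAvg c lam := by
  have h := (weightedAverage_eq c lam hlam m 0).1
  have hn : ((m + 1 : ℕ) : ℝ) ≠ 0 := by positivity
  have hn' : (m + 1 : ℝ) ≠ 0 := by exact_mod_cast hn
  unfold aggregate gainSymm
  have e1 : ∑ e : Fin (m + 1) → E, 1 / (m + 1 : ℝ) * tupleBeta c e * tupleLam lam e =
      (1 / (m + 1 : ℝ)) * ∑ e : Fin (m + 1) → E, tupleBeta c e * tupleLam lam e := by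
    rw [Finset.mul_sum]
    exact Finset.sum_congr rfl fun e _ => by ring
  rw [e1, mul_div_assoc, h]
  push_cast
  field_simp

/-- **"Symmetrizing does not affect the computation"**, as the kernel sees it: distinguished-slot and
symmetrised aggregates agree (both are `c_avg`). [claim: Mochizuki2012, status: disputed] -/
theorem aggregate_gainAt_eq_aggregate_gainSymm [Nonempty E] (c : E → ℝ) {lam : E → ℝ}
    (hlam : ∀ e, 0 < lam e) (i : Fin (m + 1)) :
    aggregate lam (gainAt c i) = aggregate lam (gainSymm (m := m) c) := by
  rw [aggregate_gainAt c hlam i, aggregate_gainSymm c hlam]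

/-! ## §3. Reading (U): the least slot gain, its aggregate, when the readings agree, how far they differ -/

omit [Fintype E] in
/-- Under (U) the per-collection gain is at most the distinguished slot's. [folklore] -/
theorem gainMin_le_gainAt (c : E → ℝ) (i : Fin (m + 1)) (e : Fin (m + 1) → E) :
    gainMin c e ≤ gainAt c i e :=
  Finset.inf'_le _ (Finset.mem_univ i)

omit [Fintype E] in
/-- Under (U) the per-collection gain is at most the symmetrised one (a minimum is at most an average).
[folklore] -/
theorem gainMin_le_gainSymm (c : E → ℝ) (e : Fin (m + 1) → E) : gainMin c e ≤ gainSymm c e := by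
  unfold gainSymm tupleBeta
  have h : ∀ k ∈ (Finset.univ : Finset (Fin (m + 1))), gainMin c e ≤ c (e k) :=
    fun k _ => gainMin_le_gainAt c k e
  have hs := Finset.card_nsmul_le_sum (Finset.univ : Finset (Fin (m + 1))) (fun k => c (e k)) _ h
  rw [Finset.card_univ, Fintype.card_fin, nsmul_eq_mul] at hs
  have hn : (0 : ℝ) < (m + 1 : ℝ) := by positivity
  rw [one_div, ← div_eq_inv_mul, le_div_iff₀ hn, mul_comm]
  exact_mod_cast hs

/-- **The (U)-aggregate never exceeds the (S)-aggregate** `c_avg`: taking the hull of the union over the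
capsule permutations can only WEAKEN the per-component upper bound of Step (v). [folklore] -/
theorem aggregate_gainMin_le [Nonempty E] (c : E → ℝ) {lam : E → ℝ} (hlam : ∀ e, 0 < lam e) :
    aggregate lam (gainMin (m := m) c) ≤ betaAvg c lam := by
  rw [← aggregate_gainAt c hlam 0]
  exact aggregate_mono hlam fun e => gainMin_le_gainAt c 0 e

omit [Fintype E] in
/-- If the gain is the same at every place over `v_ℚ`, the least slot gain IS the distinguished slot's.
[folklore] -/
theorem gainMin_eq_gainAt_of_const {c : E → ℝ} (hc : ∀ e e', c e = c e') (i : Fin (m + 1))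
    (e : Fin (m + 1) → E) : gainMin c e = gainAt c i e := by
  refine le_antisymm (gainMin_le_gainAt c i e) ?_
  unfold gainMin gainAt
  exact (Finset.le_inf'_iff _ _).2 fun k _ => (hc (e i) (e k)).le

/-- **The readings agree when the gain is constant on `V(F_mod)_{v_ℚ}`** (all places of `F_mod` over `v_ℚ`
carry the same `(j²/2l)·log(q_v)`): then the (U)-aggregate is `c_avg` too. [folklore] -/
theorem aggregate_gainMin_eq_of_const [Nonempty E] {c : E → ℝ} (hc : ∀ e e', c e = c e') {lam : E → ℝ}
    (hlam : ∀ e, 0 < lam e) : aggregate lam (gainMin (m := m) c) = betaAvg c lam := by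
  have h : gainMin (m := m) c = gainAt c 0 := funext fun e => gainMin_eq_gainAt_of_const hc 0 e
  rw [h, aggregate_gainAt c hlam 0]

/-- In particular **the readings agree when `V(F_mod)_{v_ℚ}` is a singleton** — one place of `F_mod` over
`v_ℚ`, e.g. `F_mod = ℚ` (`d_mod = 1`). [folklore] -/
theorem aggregate_gainMin_eq_of_subsingleton [Nonempty E] [Subsingleton E] (c : E → ℝ) {lam : E → ℝ}
    (hlam : ∀ e, 0 < lam e) : aggregate lam (gainMin (m := m) c) = betaAvg c lam :=
  aggregate_gainMin_eq_of_const (fun e e' => congrArg c (Subsingleton.elim e e')) hlam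

/-- **The readings differ as soon as two places over `v_ℚ` carry different gains** (and `j ≥ 1`): the
(U)-aggregate is then STRICTLY below `c_avg`. Witness collection: the place of larger gain in the
distinguished slot, the place of smaller gain in another slot. [folklore] -/
theorem aggregate_gainMin_lt [Nonempty E] {c : E → ℝ} {a b : E} (hab : c a < c b) {lam : E → ℝ}
    (hlam : ∀ e, 0 < lam e) (hm : 1 ≤ m) : aggregate lam (gainMin (m := m) c) < betaAvg c lam := by
  classical
  rw [← aggregate_gainAt c hlam 0]
  unfold aggregate
  refine div_lt_div_of_pos_right ?_ (sum_tupleLam_pos hlam)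
  -- the witness collection: `b` in slot `0 = i†`, `a` elsewhere
  let w : Fin (m + 1) → E := fun k => if k = 0 then b else a
  have hw0 : gainAt c 0 w = c b := by simp [gainAt, w]
  have h1 : (⟨1, by omega⟩ : Fin (m + 1)) ≠ 0 := by
    intro h; have := congrArg Fin.val h; simp at this
  have hwmin : gainMin c w ≤ c a := by
    have := gainMin_le_gainAt c ⟨1, by omega⟩ w
    simpa [gainAt, w, h1] using this
  refine Finset.sum_lt_sum (fun e _ => mul_le_mul_of_nonneg_right (gainMin_le_gainAt c 0 e)
    (tupleLam_pos hlam e).le) ⟨w, Finset.mem_univ _, ?_⟩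
  exact mul_lt_mul_of_pos_right (by rw [hw0]; linarith) (tupleLam_pos hlam w)

/-- The total weight of the collections AVOIDING a set `G` of places is `(λ_E − λ_G)^{j+1}`. [folklore] -/
theorem sum_tupleLam_avoiding [DecidableEq E] (lam : E → ℝ) (G : Finset E) :
    ∑ e ∈ Fintype.piFinset fun _ : Fin (m + 1) => Finset.univ \ G, tupleLam lam e =
      (lamTotal lam - ∑ e ∈ G, lam e) ^ (m + 1) := by
  simp only [tupleLam]
  rw [← Finset.prod_univ_sum (fun _ : Fin (m + 1) => Finset.univ \ G) fun _ x => lam x, Finset.prod_const,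
    Finset.card_univ, Fintype.card_fin, lamTotal, Finset.sum_sdiff_eq_sub (Finset.subset_univ G)]

/-- **Collapse of the (U)-aggregate at a prime with good places.** If every gain is `≤ M` and the
places of `G ⊆ V(F_mod)_{v_ℚ}` carry gain `0` (e.g. `G` = the places of `F_mod` over `v_ℚ` at which `E_F` has
good reduction: "`λ` to be `0` if `v_j ∈ V^good`", p. 27 l. 50), then the (U)-aggregate is at most
`M·((λ_E − λ_G)/λ_E)^{j+1} = M·(1−ω)^{j+1}`, `ω` = the weight fraction of `G`: only collections avoiding
`G` in EVERY slot retain a positive least gain. (abc-iut-c312-d1, STEPV-IND1-NOTE §4: the `−((l+1)/24)·log(q)`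
driving term "collapses" at such `v_ℚ`.) [folklore] -/
theorem aggregate_gainMin_le_collapse [Nonempty E] [DecidableEq E] {c : E → ℝ}
    {M : ℝ} (hM : ∀ e, c e ≤ M) (G : Finset E) (hG : ∀ e ∈ G, c e = 0) {lam : E → ℝ}
    (hlam : ∀ e, 0 < lam e) :
    aggregate lam (gainMin (m := m) c) ≤ M * ((lamTotal lam - ∑ e ∈ G, lam e) / lamTotal lam) ^ (m + 1) := by
  unfold aggregate
  rw [div_pow, ← sum_tupleLam_avoiding, ← mul_div_assoc, ← lamTotal_pow]
  refine div_le_div_of_nonneg_right ?_ (pow_pos (lamTotal_pos hlam) _).le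
  -- split the sum over all collections into those avoiding `G` and the rest
  let A : Finset (Fin (m + 1) → E) := Fintype.piFinset fun _ : Fin (m + 1) => Finset.univ \ G
  have hsplit := Finset.sum_filter_add_sum_filter_not (Finset.univ : Finset (Fin (m + 1) → E))
    (fun e => e ∈ A) (fun e => gainMin c e * tupleLam lam e)
  rw [← hsplit]
  have hA : (Finset.univ.filter fun e : Fin (m + 1) → E => e ∈ A) = A := by
    ext e; simp
  rw [hA, Finset.mul_sum]
  have h1 : ∑ e ∈ A, gainMin c e * tupleLam lam e ≤ ∑ e ∈ A, M * tupleLam lam e :=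
    Finset.sum_le_sum fun e _ => mul_le_mul_of_nonneg_right
      ((gainMin_le_gainAt c 0 e).trans (hM _)) (tupleLam_pos hlam e).le
  have h2 : ∑ e ∈ Finset.univ.filter (fun e : Fin (m + 1) → E => ¬ e ∈ A),
      gainMin c e * tupleLam lam e ≤ 0 := by
    refine Finset.sum_nonpos fun e he => ?_
    rw [Finset.mem_filter] at he
    -- a collection not avoiding `G` has a slot in `G`, hence least gain `≤ 0`
    have hk : ∃ k, e k ∈ G := by
      by_contra h
      push Not at h
      exact he.2 (Fintype.mem_piFinset.2 fun k => Finset.mem_sdiff.2 ⟨Finset.mem_univ _, h k⟩)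
    obtain ⟨k, hk⟩ := hk
    have : gainMin c e ≤ 0 := (gainMin_le_gainAt c k e).trans (hG _ hk).le
    exact mul_nonpos_of_nonpos_of_nonneg this (tupleLam_pos hlam e).le
  linarith

/-! ## §4. The per-collection containment sentence of Step (v), in exponent bookkeeping -/

/-- EXPONENT BOOKKEEPING for the sentence of Step (v) p. 27 l. 57–63: "the result of multiplying
"`p^{⌊λ⌋−|I|}·2^{−|I|}·log_p(R_I^×)`" by a suitable nonpositive … integer power of `p_{v_ℚ}` contains
the "union of possible images of a Θ-pilot object" discussed in Step (iv)". A family of regions indexed by an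
integer exponent, inclusion being antitone and strict in the exponent (the `p^t`-multiples of one
lattice: `p^s·Λ ⊆ p^t·Λ ↔ t ≤ s`) — the only feature of the `p`-adic situation this sentence uses. A
modelling device of the skeleton, not the real packet (abc-iut-c312-d1 `MultiradialRegionInd1Bound` has
the real-packet statement). [folklore] -/
structure ExponentBoxes (X : Type) where
  /-- the region of exponent `s` ("`p^s·Λ`") -/
  box : ℤ → Set X
  /-- inclusion is antitone and strict in the exponent -/
  box_subset_iff : ∀ s t : ℤ, box s ⊆ box t ↔ t ≤ s

namespace ExponentBoxes

variable {X : Type} (B : ExponentBoxes X)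

/-- "The box of exponent `⌊λ_{i†} − δ⌋` CONTAINS the twists at every slot": with all slot-twists
`p^{λ_k}·Λ` present in the component (reading (U)), the containment sentence of Step (v) for the exponents
`λ : S^±_{j+1} → ℤ` (`λ_k = ord` of `q_{e⃗(k)}^{j²}`, `0` at good slots) and the discrepancy
`δ = d_I + a_I ≥ 0` of Prop. 1.4 (iii). [claim: Mochizuki2012, status: disputed] -/
@[claim "Mochizuki2012" "disputed"]
def ContainsAllSlots (lam : Fin (m + 1) → ℤ) (i : Fin (m + 1)) (δ : ℝ) : Prop :=
  ∀ k : Fin (m + 1), B.box (lam k) ⊆ B.box ⌊(lam i : ℝ) - δ⌋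

/-- The containment sentence with all slot-twists present holds iff the box exponent is below EVERY
slot exponent: `⌊λ_{i†} − δ⌋ ≤ min_k λ_k`. [folklore] -/
theorem containsAllSlots_iff (lam : Fin (m + 1) → ℤ) (i : Fin (m + 1)) (δ : ℝ) :
    B.ContainsAllSlots lam i δ ↔ ∀ k, ⌊(lam i : ℝ) - δ⌋ ≤ lam k := by
  unfold ContainsAllSlots
  exact forall_congr' fun k => B.box_subset_iff _ _

/-- For the DISTINGUISHED slot alone the sentence holds (as in print, where `δ = d_I + a_I ≥ 0` only
enlarges the box): `⌊λ_{i†} − δ⌋ ≤ λ_{i†}`. [folklore] -/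
theorem contains_distinguished (lam : Fin (m + 1) → ℤ) (i : Fin (m + 1)) {δ : ℝ} (hδ : 0 ≤ δ) :
    B.box (lam i) ⊆ B.box ⌊(lam i : ℝ) - δ⌋ := by
  rw [B.box_subset_iff, Int.floor_le_iff]
  linarith

/-- With all slot-twists present the sentence still holds for collections whose slots carry ONE exponent
(e.g. a single place of `F_mod` over `v_ℚ`). [folklore] -/
theorem containsAllSlots_of_const (lam : Fin (m + 1) → ℤ) (hc : ∀ k k', lam k = lam k') (i : Fin (m + 1))
    {δ : ℝ} (hδ : 0 ≤ δ) : B.ContainsAllSlots lam i δ :=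
  fun k => hc k i ▸ B.contains_distinguished lam i hδ

/-- … but with all slot-twists present it FAILS as soon as some slot's exponent lies below
`λ_{i†} − δ − 1` — e.g. a good place (`λ_k = 0`) in a non-distinguished slot of a collection whose
distinguished place is bad with `ord(q_{v_j}^{j²}) > d_I + a_I + 1`. [folklore] -/
theorem not_containsAllSlots (lam : Fin (m + 1) → ℤ) (i k : Fin (m + 1)) {δ : ℝ}
    (hk : (lam k : ℝ) < lam i - δ - 1) : ¬ B.ContainsAllSlots lam i δ := by
  rw [containsAllSlots_iff]
  intro h
  have h1 := h k
  have h2 : ((⌊(lam i : ℝ) - δ⌋ : ℤ) : ℝ) ≤ lam k := by exact_mod_cast h1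
  have h3 := Int.lt_floor_add_one ((lam i : ℝ) - δ)
  linarith

/-- A model of `ExponentBoxes` (the sentence is not about an empty notion): exponents as thresholds on
`ℤ`, `box s = {x | s ≤ x}`. [folklore] -/
def thresholds : ExponentBoxes ℤ where
  box s := {x | s ≤ x}
  box_subset_iff s t := by
    constructor
    · intro h; exact Set.mem_setOf.1 (h (Set.mem_setOf.2 (le_refl s)))
    · intro h x hx; exact Set.mem_setOf.2 (h.trans (Set.mem_setOf.1 hx))

end ExponentBoxes

/-! ## §5. The fork at Step (v), side by side -/

/-- **The two readings of (Ind1) at Step (v), side by side** (no side taken), for one component `(j, v_ℚ)`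
(places `E = V(F_mod)_{v_ℚ}`, weights `λ_e > 0`, gains `c_e`): (S) the printed computation — distinguished
slot, then symmetrised — gives `c_avg` either way (Prop. 1.7); (U) the typed nouns — hull of the union over
the capsule permutations — give at most `c_avg`, exactly `c_avg` for constant gain.
[claim: Mochizuki2012, status: disputed] -/
theorem fork [Nonempty E] (c : E → ℝ) {lam : E → ℝ} (hlam : ∀ e, 0 < lam e) (i : Fin (m + 1)) :
    aggregate lam (gainAt c i) = betaAvg c lam ∧
      aggregate lam (gainSymm (m := m) c) = betaAvg c lam ∧
      aggregate lam (gainMin (m := m) c) ≤ betaAvg c lam ∧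
      ((∀ e e', c e = c e') → aggregate lam (gainMin (m := m) c) = betaAvg c lam) :=
  ⟨aggregate_gainAt c hlam i, aggregate_gainSymm c hlam, aggregate_gainMin_le c hlam,
    fun hc => aggregate_gainMin_eq_of_const hc hlam⟩

end Summit.ABC.IUTFork.Ind1StepV

end
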